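import Mathlib
import HarnessLib
import Summits.ResolutionOfSingularities.ResolutionOfSingularities.Theorems.WildQuotientsWildQuotientResolutionS1aJInfHalves

/-!
# S1a — THE KILL HALF IN COVER FORM: when the principal charts COVER the bad locus every move is terminal, so (K) needs no
# `jInf`-monotonicity lemma (STRATEGY-DESIGN v3.2 §1: the glued centre of (K1)–(K3) is principal at EVERY bad point)

[OURS · L1 W4.5c · lead-1 g8] — NOT statements of the manuscript; counted 0; AI-level work, weaker than expert review. Crux
stmt-ResolutionOfSingularities-17941, line `s1a-logminvertex` v6, stub `stub_winningStrategy`. Route-independent.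

OBSERVATION. Plan-1ʼs (K) `KillHalfJInf p` asks, at a model all of whose bad points are killable, for a principal centre whose principal charts MEET
every bad component and whose moves do not increase `jInf`; the last clause needs the transport of `KillableAt` across the idle region of a move
(`JInfPrincipalMoveLe`, SIG v3 — not in the tree: it requires localising principal-centre charts to invariant basic opens). But the centre that
(K1)–(K3) are designed to produce (canonical local kills glued over the bad locus, support = bad locus) is principal at EVERY bad point; then
`GModel.mem_badLocus_of_principalMove` (p598491) leaves NO bad point on any move: every move is TERMINAL, `jInf Mʼ = ⊥`, and both remaining clauses
of (K) hold for free. Hence the research statement to aim at is the COVER FORM below, and `KillHalfJInf` follows from it without any transport.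

* `KillHalfCover p` — (K) in cover form: `jInf M = ⊥ →` a principal centre whose principal-kill open CONTAINS the bad locus.
* `KillHalfCoverOn p q G ρ g₀ P`, `AuxHalfJInfOn p q G ρ g₀ P` — per-datum, `P`-relative forms (cf. `KillOrAuxRuleJInfOn`, p606842).
* `GModel.terminal_of_isMoveOf_of_cover` — a move along a principal centre covering the bad locus is terminal;
  `GModel.hits_of_cover` — a covering principal-kill open meets every irreducible component of the bad locus.
* **`killHalfJInf_of_killHalfCover`** `: p.Prime → KillHalfCover p → KillHalfJInf p`;
  **`killOrAuxRuleJInfOn_of_cover_of_aux`** — cover half + aux half (relative) ⇒ the relative rule; `killOrAuxRuleJInf_of_cover_of_aux` (absolute).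
-/

set_option linter.dupNamespace false

noncomputable section

open CategoryTheory Limits AlgebraicGeometry TopologicalSpace Topology
open Literature.AlgebraicGeometry.Resolution Literature.AlgebraicGeometry.RelativeSpec
open Summit.ResolutionOfSingularities.ResolutionOfSingularities.Theorems.WildQuotientResolution.S1
open Summit.ResolutionOfSingularities.ResolutionOfSingularities.Theorems.WildQuotientResolution.S1.NodeAtlas

namespace Summit.ResolutionOfSingularities.ResolutionOfSingularities.Theorems.WildQuotientResolution.S1

/-- **(K) IN COVER FORM** (OURS CANDIDATE research statement, asserted nowhere): at a non-terminal model over a Noetherian base all of whose bad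
points are killable (`jInf = ⊥`) there is a PRINCIPAL centre whose principal-kill open CONTAINS the bad locus (principal at every bad point, idle
elsewhere — the centre of STRATEGY-DESIGN v3.2 (K1)–(K3)). Implies `KillHalfJInf p` (`killHalfJInf_of_killHalfCover`). [OURS · L1 W4.5c] -/
def KillHalfCover (p : ℕ) : Prop :=
  ∀ ⦃X' X₁ : Scheme.{0}⦄ (q : X' ⟶ X₁) (G : Type) [Group G] [Finite G] (ρ : G →* Aut X') (g₀ : G),
    (∀ g : G, g ∈ Subgroup.zpowers g₀) →
    ∀ M : GameFrame.GModel p q G ρ g₀, M.HasNoetherianBase → ¬ M.Terminal → M.jInf = ⊥ →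
      ∃ (𝒦 : ReesFiltration M.V) (d : ℕ), IsPrincipalCentre p M.act g₀ 𝒦 d ∧ M.badLocus ⊆ M.principalKillOpen 𝒦 d

/-- **(K) in cover form, per datum and relative to `P`** (moves must stay in `P`). [OURS · L1 W4.5c] -/
def KillHalfCoverOn (p : ℕ) {X' X₁ : Scheme.{0}} (q : X' ⟶ X₁) (G : Type) [Group G] (ρ : G →* Aut X') (g₀ : G)
    (P : GameFrame.GModel p q G ρ g₀ → Prop) : Prop :=
  ∀ M : GameFrame.GModel p q G ρ g₀, P M → M.HasNoetherianBase → ¬ M.Terminal → M.jInf = ⊥ →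
    ∃ (𝒦 : ReesFiltration M.V) (d : ℕ), IsPrincipalCentre p M.act g₀ 𝒦 d ∧ M.badLocus ⊆ M.principalKillOpen 𝒦 d ∧
      ∀ M' : GameFrame.GModel p q G ρ g₀, M.IsMoveOf M' 𝒦 d → P M'

/-- **(A) per datum and relative to `P`** (the aux half of `KillOrAuxRuleJInfOn`). [OURS · L1 W4.5c] -/
def AuxHalfJInfOn (p : ℕ) {X' X₁ : Scheme.{0}} (q : X' ⟶ X₁) (G : Type) [Group G] (ρ : G →* Aut X') (g₀ : G)
    (P : GameFrame.GModel p q G ρ g₀ → Prop) : Prop :=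
  ∀ M : GameFrame.GModel p q G ρ g₀, P M → M.HasNoetherianBase → ¬ M.Terminal → M.jInf ≠ ⊥ →
    ∃ (𝒦 : ReesFiltration M.V) (d : ℕ), IsAuxCentre p M.act g₀ 𝒦 d (M.badLocus)ᶜ ∧
      ∀ M' : GameFrame.GModel p q G ρ g₀, M.IsMoveOf M' 𝒦 d → P M' ∧ M'.jInf < M.jInf

/-- The absolute aux half is the relative one with `P = ⊤`, for every cyclic datum. -/
theorem auxHalfJInfOn_of_auxHalfJInf {p : ℕ} (h : AuxHalfJInf p)
    {X' X₁ : Scheme.{0}} (q : X' ⟶ X₁) (G : Type) [Group G] [Finite G] (ρ : G →* Aut X') (g₀ : G)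
    (hG : ∀ g : G, g ∈ Subgroup.zpowers g₀) : AuxHalfJInfOn p q G ρ g₀ fun _ => True := by
  intro M _ hB hT hj
  obtain ⟨𝒦, d, haux, hmoves⟩ := h q G ρ g₀ hG M hB hT hj
  exact ⟨𝒦, d, haux, fun M' hmv => ⟨trivial, hmoves M' hmv⟩⟩

/-- The absolute cover half is the relative one with `P = ⊤`, for every cyclic datum. -/
theorem killHalfCoverOn_of_killHalfCover {p : ℕ} (h : KillHalfCover p)
    {X' X₁ : Scheme.{0}} (q : X' ⟶ X₁) (G : Type) [Group G] [Finite G] (ρ : G →* Aut X') (g₀ : G)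
    (hG : ∀ g : G, g ∈ Subgroup.zpowers g₀) : KillHalfCoverOn p q G ρ g₀ fun _ => True := by
  intro M _ hB hT hj
  obtain ⟨𝒦, d, hprin, hcov⟩ := h q G ρ g₀ hG M hB hT hj
  exact ⟨𝒦, d, hprin, hcov, fun _ _ => trivial⟩

namespace GameFrame.GModel

variable {p : ℕ} {X' X₁ : Scheme.{0}} {q : X' ⟶ X₁} {G : Type} [Group G] {ρ : G →* Aut X'} {g₀ : G}

/-- A subset of the model containing the bad locus meets every irreducible component of the bad locus. -/
theorem hits_of_cover (M : GModel p q G ρ g₀) {U : Set M.V} (hcov : M.badLocus ⊆ U) :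
    ∀ t ∈ irreducibleComponents ↥M.badLocus, ∃ x ∈ t, (x : M.V) ∈ U := by
  intro t ht
  obtain ⟨x, hx⟩ := ht.1.nonempty
  exact ⟨x, hx, hcov x.2⟩

/-- **A move along a principal centre whose principal charts COVER the bad locus is TERMINAL.** (`mem_badLocus_of_principalMove`, p598491.)
[OURS · L1 W4.5c] -/
theorem terminal_of_isMoveOf_of_cover [Finite G] (hp : p.Prime) (hG : ∀ g : G, g ∈ Subgroup.zpowers g₀) (M M' : GModel p q G ρ g₀)
    (hB : M.HasNoetherianBase) {𝒦 : ReesFiltration M.V} {d : ℕ} (hprin : IsPrincipalCentre p M.act g₀ 𝒦 d)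
    (hcov : M.badLocus ⊆ M.principalKillOpen 𝒦 d) (hmv : M.IsMoveOf M' 𝒦 d) : M'.Terminal := by
  obtain ⟨π', hbl, -, hr, hcomm⟩ := hmv
  obtain ⟨R₀, _, _, s, _, hs⟩ := hB
  rw [terminal_iff_badLocus_eq_empty, Set.eq_empty_iff_forall_notMem]
  intro v' hv'
  obtain ⟨hbad, hno⟩ := mem_badLocus_of_principalMove hp hG M M' 𝒦 d hprin π' hbl hr hcomm s hs hv'
  obtain ⟨O, hO⟩ := Set.mem_iUnion.mp (hcov hbad)
  obtain ⟨hO, hvO⟩ := Set.mem_iUnion.mp hO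
  exact hno O hO hvO

/-- … hence has `jInf = ⊥`. -/
theorem jInf_eq_bot_of_isMoveOf_of_cover [Finite G] (hp : p.Prime) (hG : ∀ g : G, g ∈ Subgroup.zpowers g₀) (M M' : GModel p q G ρ g₀)
    (hB : M.HasNoetherianBase) {𝒦 : ReesFiltration M.V} {d : ℕ} (hprin : IsPrincipalCentre p M.act g₀ 𝒦 d)
    (hcov : M.badLocus ⊆ M.principalKillOpen 𝒦 d) (hmv : M.IsMoveOf M' 𝒦 d) : M'.jInf = ⊥ :=
  M'.jInf_eq_bot_of_terminal (terminal_of_isMoveOf_of_cover hp hG M M' hB hprin hcov hmv)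

/-- … and WINS (it is terminal). -/
theorem wins_of_isMoveOf_of_cover [Finite G] (hp : p.Prime) (hG : ∀ g : G, g ∈ Subgroup.zpowers g₀) (M M' : GModel p q G ρ g₀)
    (hB : M.HasNoetherianBase) {𝒦 : ReesFiltration M.V} {d : ℕ} (hprin : IsPrincipalCentre p M.act g₀ 𝒦 d)
    (hcov : M.badLocus ⊆ M.principalKillOpen 𝒦 d) (hmv : M.IsMoveOf M' 𝒦 d) : Wins p q G ρ g₀ M' :=
  Wins.terminal M' (terminal_of_isMoveOf_of_cover hp hG M M' hB hprin hcov hmv)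

end GameFrame.GModel

/-- **THE KILL HALF FOLLOWS FROM ITS COVER FORM, WITHOUT ANY TRANSPORT LEMMA**: the moves are terminal, so `jInf Mʼ = ⊥ ≤ jInf M`.
[OURS · L1 W4.5c] -/
theorem killHalfJInf_of_killHalfCover {p : ℕ} (hp : p.Prime) (h : KillHalfCover p) : KillHalfJInf p := by
  intro X' X₁ q G _ _ ρ g₀ hG M hB hT hj
  obtain ⟨𝒦, d, hprin, hcov⟩ := h q G ρ g₀ hG M hB hT hj
  refine ⟨𝒦, d, hprin, M.hits_of_cover hcov, fun M' hmv => ?_⟩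
  rw [GameFrame.GModel.jInf_eq_bot_of_isMoveOf_of_cover hp hG M M' hB hprin hcov hmv]
  exact bot_le

/-- **Relative form: cover half + aux half ⇒ the relative rule** `KillOrAuxRuleJInfOn`. [OURS · L1 W4.5c] -/
theorem killOrAuxRuleJInfOn_of_cover_of_aux {p : ℕ} (hp : p.Prime) {X' X₁ : Scheme.{0}} {q : X' ⟶ X₁} {G : Type} [Group G] [Finite G]
    {ρ : G →* Aut X'} {g₀ : G} (hG : ∀ g : G, g ∈ Subgroup.zpowers g₀) {P : GameFrame.GModel p q G ρ g₀ → Prop}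
    (hK : KillHalfCoverOn p q G ρ g₀ P) (hA : AuxHalfJInfOn p q G ρ g₀ P) : KillOrAuxRuleJInfOn p q G ρ g₀ P := by
  intro M hPM hB hT
  by_cases hj : M.jInf = ⊥
  · obtain ⟨𝒦, d, hprin, hcov, hmoves⟩ := hK M hPM hB hT hj
    refine Or.inl ⟨𝒦, d, hprin, M.hits_of_cover hcov, fun M' hmv => ⟨hmoves M' hmv, ?_⟩⟩
    rw [GameFrame.GModel.jInf_eq_bot_of_isMoveOf_of_cover hp hG M M' hB hprin hcov hmv]
    exact bot_le
  · exact Or.inr (hA M hPM hB hT hj)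

/-- Absolute form: cover half + aux half ⇒ the rule of record. [OURS · L1 W4.5c] -/
theorem killOrAuxRuleJInf_of_cover_of_aux {p : ℕ} (hp : p.Prime) (hK : KillHalfCover p) (hA : AuxHalfJInf p) : KillOrAuxRuleJInf p :=
  killOrAuxRuleJInf_of_halves (killHalfJInf_of_killHalfCover hp hK) hA

/-- **The one-move win of a covering principal centre, relative form**: if at EVERY non-terminal `P`-model of a datum over a field some principal
centre covers the bad locus (no `jInf` hypothesis, no aux moves), every `P`-model wins — the uniformly-killable class. [OURS · L1 W4.5c] -/
theorem GameFrame.GModel.wins_of_cover_everywhere {p : ℕ} {X' X₁ : Scheme.{0}} {q : X' ⟶ X₁} {G : Type} [Group G] [Finite G]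
    {ρ : G →* Aut X'} {g₀ : G} (hp : p.Prime) (hG : ∀ g : G, g ∈ Subgroup.zpowers g₀) {k : Type} [Field k]
    (f : X₁ ⟶ Spec (.of k)) [LocallyOfFiniteType f] [QuasiCompact f] [IsFinite q] {P : GModel p q G ρ g₀ → Prop}
    (h : ∀ M : GModel p q G ρ g₀, P M → ¬ M.Terminal →
      ∃ (𝒦 : ReesFiltration M.V) (d : ℕ), IsPrincipalCentre p M.act g₀ 𝒦 d ∧ M.badLocus ⊆ M.principalKillOpen 𝒦 d)
    (M₀ : GModel p q G ρ g₀) (hP₀ : P M₀) : Wins p q G ρ g₀ M₀ := by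
  by_cases hT : M₀.Terminal
  · exact Wins.terminal M₀ hT
  obtain ⟨𝒦, d, hprin, hcov⟩ := h M₀ hP₀ hT
  exact Wins.of_moves 𝒦 d (isAdmissibleCentre_of_isPrincipalCentre hprin) fun M' hmv =>
    wins_of_isMoveOf_of_cover hp hG M₀ M' (hasNoetherianBase_of_datum f M₀) hprin hcov hmv

end Summit.ResolutionOfSingularities.ResolutionOfSingularities.Theorems.WildQuotientResolution.S1

end
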